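import Summits.BirchSwinnertonDyer.Rank1Residual.GaloisImage.KolyvaginPrimeOfFrobeniusClass
import Summits.BirchSwinnertonDyer.Rank1Residual.GaloisImage.TorsionPadicIntCoefficientsLocal
import HarnessLib

/-!
# The canonical `τ`-class primes on `E[3^m·3]` are Kolyvagin primes of level `m + 1`
# (located sub-item E1-deep of ★ PK-6₂; cell `b2b-bsdres`, team n1011, seat p13 GEN 14)

HONEST FRAMING (cell `b2b-bsdres`, run/shared/lean/b2b/bsd-rank1-residual/, verbatim in every
file): the goal of the cell is to DELETE the COMBINATION-SHAPED residual classes of the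
Birch–Swinnerton-Dyer formula for ALL analytic-rank `≤ 1` elliptic curves over `ℚ` — "full BSD
formula for every rank `≤ 1` curve in class `C`" assembled STRICTLY from published theorems — so
that the rank-`≤ 1` remainder becomes exactly the CONSTRUCTION-SHAPED classes, which are TYPED
(missing-input `Prop`s), NOT attempted. This is not "finishing BSD". Team n1011: research route on
the CONSTRUCTION-SHAPED class X4 / §I N11 (route-1 PORT).  This file is a TOOL theorem (curve-level
arithmetic of the `τ`-class), closing nothing on N11 by itself; 0 defs / 0 facts / 0 sorry.

## What

`KolyvaginPrime.isKolyvaginPrime_succ_of_mem_frobeniusClassPrimes` — for `W/ℚ` globally minimal, a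
depth `m`, a set of places `S` containing the bad places, `τ ∈ Gal(ℚ̄/ℚ(μ_{3^{m+1}}))` with
Sakamoto's (H.2) `E[3^m·3]/(τ − 1) ≃ ℤ/3^{m+1}` and a place
`v ∈ frobeniusClassPrimes (E[3^m·3]) S τ 3^{m+1}` — EXACTLY the data of the With-guard
`KolyvaginDatum.IsCanonicalTauDatumThreeAtWith` (n1011-p18, PORT′/PORT″) — the prime `ℓ` of `v` is a
Kolyvagin prime of level `m + 1`: `Kato.IsKolyvaginPrime W 3 (m+1) ℓ` (`ℓ ∤ 3N_E`,
`ℓ ≡ 1 (mod 3^{m+1})`, `a_ℓ ≡ ℓ + 1 (mod 3^{m+1})`).  This is the binder `hKol`/`hKol″` of THEOREM D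
(D4/D6/D7) at the depths `≥ 1` and the input of ★ PK-6₂'s wrapper
(`katoKuriharaPortThreeAtWith₂_of_zetaBody`); the level-one case is n1011-p13's E1
`isKolyvaginPrime_one_of_mem_frobeniusClassPrimes`.

## How (no field: `ℤ/3^{m+1}` is not a domain, so E1's eigenvalue argument is replaced)

`σ` fixes `μ_{3^{m+1}}` (it agrees with `τ` there) ⟹ `ℓ ≡ 1 (mod 3^{m+1})`
(`pow_mem_rootsOfUnityFixer_iff_of_isArithFrobAtPlace`).  On `E[3^{m+1}]`:
`charpoly(σ) = X² − a_ℓX + ℓ` over `ℤ/3^{m+1}` (`TorsionComparison.charpoly_zmodEnd_torsion_frobenius`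
at level `m + 1`) and `ρ(σ) = ρ(τ)`; **`charpoly(τ)(1) = det(1 − ρ(τ)) = 0`** because
`det(1 − ρ(τ))` kills the cokernel of `1 − ρ(τ)` (adjugate: `f ∘ adj f = det f · id`,
`det_smul_mem_range`) while that cokernel `E[3^{m+1}]/(τ − 1) ≃ ℤ/3^{m+1}` (H.2) is a faithful
`ℤ/3^{m+1}`-module (exponent `3^{m+1}`); hence `1 − a_ℓ + ℓ = 0` in `ℤ/3^{m+1}`.  The two level
spellings `E[3^m·3]` (the guard's) and `E[3^{m+1}]` (the charpoly tool's) are the same subgroup of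
`E(ℚ̄)` (`TorsionCoeff.geomTorsion_pow_succ_eq`); the `ℤ/3^{m+1}`-structure facts are transported
along it.

References: R. Sakamoto, JTNB 36 (2024) §2 (the set 𝒫, (H.2)) [Sakamoto2024]; C.-H. Kim, AJM 148
(2026) §1.2.2 [Kim2022StructureSelmer]; J. H. Silverman, *AEC* V.2.3, VII.7.1 (with C.21.3)
[SilvermanAEC2009]; design `cells/n1011/ROUTE-1.md` §60 / lead R5-112 (a), R5-113 (c).
-/

noncomputable section

open scoped Classical NumberField
open Polynomial Field NumberField IsDedekindDomain
open WeierstrassCurve Literature.NumberTheory.EllipticCurves Literature.NumberTheory.GaloisRepresentations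
  Literature.NumberTheory.GaloisRepresentations.DiscreteGaloisModule Literature.NumberTheory.GaloisCohomology
open Rat.HeightOneSpectrum

namespace Summit.BirchSwinnertonDyer.Rank1Residual.GaloisImage.KolyvaginPrime

open Summit.BirchSwinnertonDyer.Rank1Residual.GaloisImage

/-! ### The determinant of an endomorphism kills its cokernel -/

/-- **`det f • x ∈ range f`** for an endomorphism `f` of a finite free module over a commutative
ring (the adjugate identity `f ∘ adj(f) = det f · id` read through a basis). [folklore] -/
theorem det_smul_mem_range {R M : Type*} [CommRing R] [AddCommGroup M] [Module R M] [Module.Free R M]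
    [Module.Finite R M] (f : Module.End R M) (x : M) : LinearMap.det f • x ∈ LinearMap.range f := by
  let b := Module.Free.chooseBasis R M
  refine ⟨Matrix.toLin b b (Matrix.adjugate (LinearMap.toMatrix b b f)) x, ?_⟩
  have hcomp : f (Matrix.toLin b b (Matrix.adjugate (LinearMap.toMatrix b b f)) x) =
      Matrix.toLin b b (LinearMap.toMatrix b b f * Matrix.adjugate (LinearMap.toMatrix b b f)) x := by
    rw [Matrix.toLin_mul b b b, LinearMap.comp_apply, Matrix.toLin_toMatrix]
  rw [hcomp, Matrix.mul_adjugate, map_smul, Matrix.toLin_one, LinearMap.smul_apply,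
    LinearMap.id_apply, LinearMap.det_toMatrix]

/-! ### The class primes are Kolyvagin primes of the class's level -/

variable (W : WeierstrassCurve ℚ) [W.IsElliptic] [W.IsGloballyMinimal]

set_option backward.isDefEq.respectTransparency false in
/-- **Every prime of the canonical `τ`-class on `E[3^m·3]` is a Kolyvagin prime of level
`m + 1`.**  For `τ ∈ Gal(ℚ̄/ℚ(μ_{3^{m+1}}))` with `E[3^m·3]/(τ − 1) ≅ ℤ/3^{m+1}` (Sakamoto's (H.2)
datum at depth `m`) and a finite place `v ∈ frobeniusClassPrimes (E[3^m·3]) S τ 3^{m+1}` (`v ∉ S ⊇`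
the bad places, `v ∤ 3`, a Frobenius `σ` at `v` with `ρ(σ) = ρ(τ)` on `E[3^m·3]` and `σ ≡ τ` on
`μ_{3^{m+1}}`): the prime `ℓ` of `v` satisfies `ℓ ∤ 3N_E`, `ℓ ≡ 1 (mod 3^{m+1})` and
`a_ℓ ≡ ℓ + 1 (mod 3^{m+1})` — `charpoly(σ | E[3^{m+1}]) = X² − a_ℓX + ℓ` equals `charpoly(τ)`, whose
value at `1`, `det(1 − ρ(τ))`, kills the faithful `ℤ/3^{m+1}`-module `E[3^{m+1}]/(τ − 1) ≅ ℤ/3^{m+1}`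
and so vanishes.  The binder `hKol` of THEOREM D at depth `m`; the level-one case is
`isKolyvaginPrime_one_of_mem_frobeniusClassPrimes`.
[cite: Sakamoto2024, §2 (H.2) and the set 𝒫 (pp. 920–921)] [cite: Kim2022StructureSelmer, §1.2.2]
[cite: SilvermanAEC2009, Prop. V.2.3 and Thm. VII.7.1] -/
theorem isKolyvaginPrime_succ_of_mem_frobeniusClassPrimes (m : ℕ)
    {S : Set (HeightOneSpectrum (𝓞 ℚ))} (hSbad : ∀ v ∉ S, W.HasGoodReductionAt v)
    {τ : absoluteGaloisGroup ℚ} (hτμ : τ ∈ rootsOfUnityFixer ℚ (3 ^ (m + 1)))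
    (hτq : Nonempty (cokerSubOne (W.torsionGaloisModule (((3 : ℕ) : ℤ) ^ m * ((3 : ℕ) : ℤ))) τ ≃+
      ZMod (3 ^ (m + 1))))
    {v : HeightOneSpectrum (𝓞 ℚ)}
    (hv : v ∈ frobeniusClassPrimes (W.torsionGaloisModule (((3 : ℕ) : ℤ) ^ m * ((3 : ℕ) : ℤ)))
      S τ (3 ^ (m + 1))) :
    Kato.IsKolyvaginPrime W 3 (m + 1) ((primesEquiv v : Nat.Primes) : ℕ) := by
  -- the two spellings of the level agree
  have hm : ((3 : ℕ) : ℤ) ^ m * ((3 : ℕ) : ℤ) = ((3 ^ (m + 1) : ℕ) : ℤ) := by push_cast; ring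
  rw [hm] at hv hτq
  obtain ⟨hvS, hv3, -, σ, hσ, hρ, hζ⟩ := hv
  have hℓ : ((primesEquiv v : Nat.Primes) : ℕ).Prime := (primesEquiv v).2
  have hgood : W.HasGoodReductionAt v := hSbad v hvS
  have hℓ3 : ((primesEquiv v : Nat.Primes) : ℕ) ≠ 3 := by
    intro h
    apply hv3
    rw [Nat.cast_pow]
    exact Ideal.pow_mem_of_mem _ (KolyvaginPrime.natCast_mem_asIdeal_of_primesEquiv_eq h) _
      (Nat.succ_le_succ (Nat.zero_le m))
  have hn : ¬ ((primesEquiv v : Nat.Primes) : ℕ) ∣ 3 ^ (m + 1) := fun h =>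
    hℓ3 ((Nat.prime_dvd_prime_iff_eq hℓ Nat.prime_three).mp (hℓ.dvd_of_dvd_pow h))
  -- (1) `σ` fixes `μ_{3^{m+1}}`, hence `ℓ ≡ 1 (mod 3^{m+1})`
  have hσμ : σ ∈ rootsOfUnityFixer ℚ (3 ^ (m + 1)) := by
    intro t ht
    have h1 := hζ t ht
    have h2 := hτμ t ht
    calc σ • t = (σ * τ⁻¹ * τ) • t := by rw [inv_mul_cancel_right]
      _ = (σ * τ⁻¹) • (τ • t) := mul_smul _ _ _
      _ = t := by rw [h2, h1]
  have hℓ1 : ((primesEquiv v : Nat.Primes) : ℕ) ≡ 1 [MOD 3 ^ (m + 1)] := by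
    have := (CyclotomicLevel.Rat.pow_mem_rootsOfUnityFixer_iff_of_isArithFrobAtPlace hn hσ 1).mp
      (by rwa [pow_one])
    rwa [pow_one] at this
  -- (2) the `ℤ/3^{m+1}`-module `E[3^{m+1}]` (spelling of the charpoly tool), free of rank two and
  -- finite by transport from the `E[3^m·3]` spelling along the equality of the two subgroups
  letI instM : Module (ZMod (3 ^ (m + 1))) (geomTorsion W ((3 ^ (m + 1) : ℕ) : ℤ)) :=
    AddSubgroup.torsionBy.zmodModule
  let eA : geomTorsion W ((3 ^ (m + 1) : ℕ) : ℤ) ≃+ geomTorsion W (((3 : ℕ) : ℤ) ^ m * ((3 : ℕ) : ℤ)) :=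
    AddEquiv.addSubgroupCongr (TorsionCoeff.geomTorsion_pow_succ_eq W 3 m)
  let eL : geomTorsion W ((3 ^ (m + 1) : ℕ) : ℤ) ≃ₗ[ZMod (3 ^ (m + 1))]
      geomTorsion W (((3 : ℕ) : ℤ) ^ m * ((3 : ℕ) : ℤ)) :=
    LinearEquiv.ofBijective (eA.toAddMonoidHom.toZModLinearMap (3 ^ (m + 1)))
      (by rw [AddMonoidHom.coe_toZModLinearMap]; exact eA.bijective)
  letI instFree : Module.Free (ZMod (3 ^ (m + 1))) (geomTorsion W ((3 ^ (m + 1) : ℕ) : ℤ)) :=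
    Module.Free.of_equiv eL.symm
  letI instFin : Module.Finite (ZMod (3 ^ (m + 1))) (geomTorsion W ((3 ^ (m + 1) : ℕ) : ℤ)) :=
    Module.Finite.equiv eL.symm
  -- (3) `charpoly(σ) = X² − a_ℓ X + ℓ` and `ρ σ = ρ τ`
  have hchar := TorsionComparison.charpoly_zmodEnd_torsion_frobenius W 3 (m + 1) hℓ3 hgood hσ
  have hend : (W.torsionGaloisModule ((3 ^ (m + 1) : ℕ) : ℤ)).zmodEnd (3 ^ (m + 1)) σ =
      (W.torsionGaloisModule ((3 ^ (m + 1) : ℕ) : ℤ)).zmodEnd (3 ^ (m + 1)) τ := by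
    apply LinearMap.ext
    intro x
    rw [zmodEnd_apply, zmodEnd_apply]
    have h := hρ (W.torsionGaloisModule ((3 ^ (m + 1) : ℕ) : ℤ) τ x)
    rw [torsionGaloisModule_apply_apply, torsionGaloisModule_apply_apply, mul_smul,
      inv_smul_smul] at h
    exact h
  rw [hend] at hchar
  -- (4) `det(1 − ρ τ) = 0`: it kills the cokernel `E[3^{m+1}]/(τ − 1) ≃ ℤ/3^{m+1}`, of exponent `3^{m+1}`
  set f : Module.End (ZMod (3 ^ (m + 1))) (geomTorsion W ((3 ^ (m + 1) : ℕ) : ℤ)) :=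
    (W.torsionGaloisModule ((3 ^ (m + 1) : ℕ) : ℤ)).zmodEnd (3 ^ (m + 1)) τ with hf
  set dlt : ZMod (3 ^ (m + 1)) := LinearMap.det (1 - f) with hdlt
  have hrange : ∀ x : geomTorsion W ((3 ^ (m + 1) : ℕ) : ℤ), dlt • x ∈
      ((W.torsionGaloisModule ((3 ^ (m + 1) : ℕ) : ℤ) τ).toAddMonoidHom -
        AddMonoidHom.id _).range := by
    intro x
    obtain ⟨y, hy⟩ := det_smul_mem_range (1 - f) x
    refine ⟨-y, ?_⟩
    rw [← hy]
    change W.torsionGaloisModule ((3 ^ (m + 1) : ℕ) : ℤ) τ (-y) - (-y) = y - f y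
    rw [map_neg, zmodEnd_apply]
    abel
  have hdlt0 : dlt = 0 := by
    obtain ⟨e⟩ := hτq
    -- `dlt.val` kills the cokernel, hence `ℤ/3^{m+1}`
    have hq : ∀ q : cokerSubOne (W.torsionGaloisModule ((3 ^ (m + 1) : ℕ) : ℤ)) τ, dlt.val • q = 0 := by
      intro q
      obtain ⟨x, rfl⟩ := QuotientAddGroup.mk_surjective q
      rw [← QuotientAddGroup.mk_nsmul, QuotientAddGroup.eq_zero_iff,
        ← TorsionComparison.zmod_smul_eq_val_smul]
      exact hrange x
    have h1 : (dlt.val : ZMod (3 ^ (m + 1))) = 0 := by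
      have h := hq (e.symm 1)
      apply_fun e at h
      rw [map_nsmul, AddEquiv.apply_symm_apply, map_zero, Nat.smul_one_eq_cast] at h
      exact h
    rwa [ZMod.natCast_zmod_val] at h1
  -- (5) read off `1 − a_ℓ + ℓ = 0` in `ℤ/3^{m+1}`
  have heval : (1 : ZMod (3 ^ (m + 1))) -
      ((W.frobeniusTrace (primesEquiv v) : ℤ) : ZMod (3 ^ (m + 1))) +
      ((((primesEquiv v : Nat.Primes) : ℕ) : ℕ) : ZMod (3 ^ (m + 1))) = 0 := by
    have h : f.charpoly.eval 1 = 0 := by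
      rw [LinearMap.eval_charpoly, map_one, ← hdlt, hdlt0]
    rw [hf, hchar] at h
    simp only [eval_add, eval_sub, eval_pow, eval_X, eval_mul, eval_C, one_pow, mul_one] at h
    exact h
  refine ⟨hℓ, ?_, hℓ1, ?_⟩
  · -- `ℓ ∤ N_W · 3`
    intro hdvd
    rcases (Nat.Prime.dvd_mul hℓ).mp hdvd with h | h
    · exact ((W.dvd_conductorNorm_iff v).mp h) hgood
    · exact hℓ3 ((Nat.prime_dvd_prime_iff_eq hℓ Nat.prime_three).mp h)
  · -- `a_ℓ ≡ ℓ + 1 (mod 3^{m+1})`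
    refine (ZMod.intCast_eq_intCast_iff _ _ (3 ^ (m + 1))).mp ?_
    push_cast
    linear_combination -heval

/-- The same read at any LOWER level `j + 1 ≤ m + 1` (`𝒫_{m+1} ⊆ 𝒫_{j+1}`): the form THEOREM D's
`hKol` takes for a depth-`j` datum guarded by the DEEP class of depth `m = j + t` (PORT′/PORT″'s
`IsCanonicalTauDatumThreeAtWith W (j + t) j η D`). [cite: Kim2022StructureSelmer, §1.2.2 and §1.4.2] -/
theorem isKolyvaginPrime_of_mem_frobeniusClassPrimes_of_le {j m : ℕ} (hjm : j ≤ m)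
    {S : Set (HeightOneSpectrum (𝓞 ℚ))} (hSbad : ∀ v ∉ S, W.HasGoodReductionAt v)
    {τ : absoluteGaloisGroup ℚ} (hτμ : τ ∈ rootsOfUnityFixer ℚ (3 ^ (m + 1)))
    (hτq : Nonempty (cokerSubOne (W.torsionGaloisModule (((3 : ℕ) : ℤ) ^ m * ((3 : ℕ) : ℤ))) τ ≃+
      ZMod (3 ^ (m + 1))))
    {v : HeightOneSpectrum (𝓞 ℚ)}
    (hv : v ∈ frobeniusClassPrimes (W.torsionGaloisModule (((3 : ℕ) : ℤ) ^ m * ((3 : ℕ) : ℤ)))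
      S τ (3 ^ (m + 1))) :
    Kato.IsKolyvaginPrime W 3 (j + 1) ((primesEquiv v : Nat.Primes) : ℕ) :=
  (isKolyvaginPrime_succ_of_mem_frobeniusClassPrimes W m hSbad hτμ hτq hv).mono
    (Nat.succ_le_succ hjm)

end Summit.BirchSwinnertonDyer.Rank1Residual.GaloisImage.KolyvaginPrime

end
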